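import Mathlib
import Literature.NumberTheory.Transcendental.SemialgebraicMapsProofs
import Literature.NumberTheory.Transcendental.SemialgebraicVolume
import Literature.ModelTheory.ExponentialFields.SemialgebraicInterior
import Literature.NumberTheory.Transcendental.SemialgebraicMapsSmoothProofs
import Literature.NumberTheory.Transcendental.KZLogCalculusProofs

/-!
# Crux `SymplecticScissors.PlanarSAZylev` (stmt-KontsevichZagierPeriods-9848),
line `reservoir-peeling`, stub `stub_groundCell`: stacking ordered bands by vertical shears

The pinned relation `E A B` says: an open co-null `ℚ`-semialgebraic part `U` of `A` is carried by
one `ℚ`-semialgebraic `C¹` injection `Φ` with `|det DΦ| = 1` onto a co-null part of `B`.  We prove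
the GROUNDING OF ONE CYLINDER: over an open `ℚ`-semialgebraic `C ⊆ ℝ¹`, finitely many bands
`fᵢ < t < gᵢ` (continuous `ℚ`-semialgebraic bounds, ordered: `gᵢ ≤ fᵢ'` for `i < i'`) satisfy
`E (⋃ᵢ bandᵢ) {(x, t) | x ∈ C, 0 < t < Σᵢ (gᵢ x − fᵢ x)}`, granted the gluing property of `E`
(a hypothesis of the stub).

* `groundCell_shear`: ONE band `a < t < b` over an open `ℚ`-semialgebraic `G` is carried onto the
  band `a + η < t < b + η` by the vertical shear `Φ (x, t) = (x, t + η x)` whenever `η` is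
  `ℚ`-semialgebraic and `C¹` on `G`: `Φ` is a `ℚ`-semialgebraic `C¹` injection whose derivative
  `w ↦ (init w, w_last + Dη (init w))` has determinant `1` (`LinearMap.det_of_snoc_init`).
* `groundCell_band`: over an open `ℚ`-semialgebraic `C`, the band `a < t < b` is `E`-related to
  `S < t < S + (b − a)` for every `ℚ`-semialgebraic `S`: the shift `η = S − a` is `C^∞` on an open
  `ℚ`-semialgebraic `G ⊆ C` with `C \ G` null (`KZ.exists_isOpen_contDiffOn`, Bochnak–Coste–Roy
  1998, §2.9), and the cylinder over `C \ G` is null (`KZ.volume_setOf_init_mem_eq_zero`).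
* `stub_groundCell`: induction on the number of bands (`k = 0`: `E ∅ ∅` with `U = ∅`); the
  first `k` bands are stacked onto
  `0 < t < S_k`, `S_k = Σ_{i<k} (gᵢ − fᵢ)`, the last one onto `S_k < t < S_k + (g_k − f_k)`; the
  sources are disjoint by the ordering, the targets are disjoint, so the instances glue, and the
  glued target fills `0 < t < S_{k+1}` up to the null graph `t = S_k x` (`KZ.volume_graph_eq_zero`).

Sources: grounding (discrete Steiner symmetrisation) is folklore bookkeeping; semialgebraic
functions are smooth off a thin set: Bochnak–Coste–Roy 1998, §2.9.  No new definitions. -/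

noncomputable section

open MeasureTheory Set
open Literature.NumberTheory.Transcendental Literature.ModelTheory.ExponentialFields

namespace Summit.KontsevichZagierPeriods.SymplecticScissors.PlanarSAZylev

/-- An open band `{(x, t) | x ∈ G, a x < t < b x}` with `ℚ`-semialgebraic edges over a
`ℚ`-semialgebraic base is `ℚ`-semialgebraic (closed band minus the two graphs). [folklore] -/
theorem groundCell_isSemialgebraic_band {G : Set (Fin 1 → ℝ)} {a b : (Fin 1 → ℝ) → ℝ}
    (ha : IsSemialgebraicFunOn ℚ G a) (hb : IsSemialgebraicFunOn ℚ G b) :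
    IsSemialgebraic ℚ {z : Fin 2 → ℝ | Fin.init z ∈ G ∧ a (Fin.init z) < z (Fin.last 1) ∧
      z (Fin.last 1) < b (Fin.init z)} := by
  -- adapted from `KZ.of_sub_of_restrict_openBand_mem_relations` (KZHomotopyMoves.lean)
  have hGa : IsSemialgebraic ℚ
      {z : Fin 2 → ℝ | Fin.init z ∈ G ∧ z (Fin.last 1) = a (Fin.init z)} :=
    isSemialgebraicFunOn_iff.mp ha
  have hGb : IsSemialgebraic ℚ
      {z : Fin 2 → ℝ | Fin.init z ∈ G ∧ z (Fin.last 1) = b (Fin.init z)} :=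
    isSemialgebraicFunOn_iff.mp hb
  have h := (KZlog.isSemialgebraic_band ha hb).diff (hGa.union hGb)
  convert h using 1
  ext z
  simp only [mem_setOf_eq, mem_sdiff, mem_union, KZlog.mem_band, not_or, not_and]
  constructor
  · rintro ⟨hzB, h1, h2⟩
    exact ⟨⟨hzB, h1.le, h2.le⟩, fun _ => h1.ne', fun _ => h2.ne⟩
  · rintro ⟨⟨hzB, h1, h2⟩, h3, h4⟩
    exact ⟨hzB, lt_of_le_of_ne h1 (fun h => h3 hzB h.symm), lt_of_le_of_ne h2 (h4 hzB)⟩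

/-- An open band `{(x, t) | x ∈ G, a x < t < b x}` over an open base with edges continuous on the
base is open. [folklore] -/
theorem groundCell_isOpen_band {G : Set (Fin 1 → ℝ)} {a b : (Fin 1 → ℝ) → ℝ} (hGo : IsOpen G)
    (hac : ContinuousOn a G) (hbc : ContinuousOn b G) :
    IsOpen {z : Fin 2 → ℝ | Fin.init z ∈ G ∧ a (Fin.init z) < z (Fin.last 1) ∧
      z (Fin.last 1) < b (Fin.init z)} := by
  have hc : Continuous (Fin.init : (Fin 2 → ℝ) → Fin 1 → ℝ) := continuous_id.finInit
  set O : Set (Fin 2 → ℝ) := {z | Fin.init z ∈ G} with hO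
  have hl : ContinuousOn (fun z : Fin 2 → ℝ => z (Fin.last 1)) O :=
    (continuous_apply (Fin.last 1)).continuousOn
  have ha' : ContinuousOn (fun z : Fin 2 → ℝ => a (Fin.init z)) O :=
    hac.comp hc.continuousOn fun z hz => hz
  have hb' : ContinuousOn (fun z : Fin 2 → ℝ => b (Fin.init z)) O :=
    hbc.comp hc.continuousOn fun z hz => hz
  have h1 : IsOpen (O ∩ (fun z : Fin 2 → ℝ => z (Fin.last 1) - a (Fin.init z)) ⁻¹' Ioi 0) :=
    (hl.sub ha').isOpen_inter_preimage (hGo.preimage hc) isOpen_Ioi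
  have h2 : IsOpen (O ∩ (fun z : Fin 2 → ℝ => z (Fin.last 1) - a (Fin.init z)) ⁻¹' Ioi 0 ∩
      (fun z : Fin 2 → ℝ => b (Fin.init z) - z (Fin.last 1)) ⁻¹' Ioi 0) :=
    ((hb'.sub hl).mono inter_subset_left).isOpen_inter_preimage h1 isOpen_Ioi
  convert h2 using 1
  ext z
  simp only [hO, mem_setOf_eq, mem_inter_iff, mem_preimage, mem_Ioi, sub_pos, and_assoc]

/-- Enlarging source and target of an instance of `E` by null sets. [folklore] -/
theorem groundCell_enlarge (E : Set (Fin 2 → ℝ) → Set (Fin 2 → ℝ) → Prop)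
    (HE : ∀ A B : Set (Fin 2 → ℝ), E A B ↔
        ∃ (U : Set (Fin 2 → ℝ)) (Φ : (Fin 2 → ℝ) → (Fin 2 → ℝ)),
          U ⊆ A ∧ IsSemialgebraic ℚ U ∧ IsOpen U ∧ volume (A \ U) = 0 ∧
          IsSemialgebraicMapOn ℚ U Φ ∧ ContDiffOn ℝ 1 Φ U ∧ InjOn Φ U ∧
          (∀ p ∈ U, |(fderiv ℝ Φ p).det| = 1) ∧ Φ '' U ⊆ B ∧ volume (B \ Φ '' U) = 0)
    {A A' B B' : Set (Fin 2 → ℝ)} (h : E A B) (hA : A ⊆ A') (hA' : volume (A' \ A) = 0)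
    (hB : B ⊆ B') (hB' : volume (B' \ B) = 0) : E A' B' := by
  obtain ⟨U, Φ, hUA, hUsa, hUo, hAU, hΦsa, hΦC1, hinj, hdet, hΦB, hBΦ⟩ := (HE A B).1 h
  refine (HE A' B').2 ⟨U, Φ, hUA.trans hA, hUsa, hUo, ?_, hΦsa, hΦC1, hinj, hdet, hΦB.trans hB, ?_⟩
  · refine measure_mono_null (fun x hx => ?_) (measure_union_null hA' hAU)
    by_cases hxA : x ∈ A
    · exact Or.inr ⟨hxA, hx.2⟩
    · exact Or.inl ⟨hx.1, hxA⟩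
  · refine measure_mono_null (fun x hx => ?_) (measure_union_null hB' hBΦ)
    by_cases hxB : x ∈ B
    · exact Or.inr ⟨hxB, hx.2⟩
    · exact Or.inl ⟨hx.1, hxB⟩

/-- **One vertical shear.** Over an open `ℚ`-semialgebraic `G ⊆ ℝ¹` let `a, b` be continuous and
`ℚ`-semialgebraic and `η` be `ℚ`-semialgebraic and `C¹`.  Then the shear `Φ (x, t) = (x, t + η x)`
witnesses `E {a < t < b} {a + η < t < b + η}` (bands over `G`): it is `ℚ`-semialgebraic
(coordinates: a coordinate function, and a coordinate plus `η ∘ init`), `C¹`, injective, its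
derivative `w ↦ (init w, w_last + Dη_x (init w))` has determinant `1`
(`LinearMap.det_of_snoc_init`), and it maps the first band onto the second. [folklore] -/
theorem groundCell_shear (E : Set (Fin 2 → ℝ) → Set (Fin 2 → ℝ) → Prop)
    (HE : ∀ A B : Set (Fin 2 → ℝ), E A B ↔
        ∃ (U : Set (Fin 2 → ℝ)) (Φ : (Fin 2 → ℝ) → (Fin 2 → ℝ)),
          U ⊆ A ∧ IsSemialgebraic ℚ U ∧ IsOpen U ∧ volume (A \ U) = 0 ∧
          IsSemialgebraicMapOn ℚ U Φ ∧ ContDiffOn ℝ 1 Φ U ∧ InjOn Φ U ∧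
          (∀ p ∈ U, |(fderiv ℝ Φ p).det| = 1) ∧ Φ '' U ⊆ B ∧ volume (B \ Φ '' U) = 0)
    {G : Set (Fin 1 → ℝ)} {a b η : (Fin 1 → ℝ) → ℝ} (hGo : IsOpen G)
    (ha : IsSemialgebraicFunOn ℚ G a) (hb : IsSemialgebraicFunOn ℚ G b)
    (hη : IsSemialgebraicFunOn ℚ G η) (hac : ContinuousOn a G) (hbc : ContinuousOn b G)
    (hηd : ContDiffOn ℝ 1 η G) :
    E {z : Fin 2 → ℝ | Fin.init z ∈ G ∧ a (Fin.init z) < z (Fin.last 1) ∧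
        z (Fin.last 1) < b (Fin.init z)}
      {z : Fin 2 → ℝ | Fin.init z ∈ G ∧ a (Fin.init z) + η (Fin.init z) < z (Fin.last 1) ∧
        z (Fin.last 1) < b (Fin.init z) + η (Fin.init z)} := by
  -- adapted from `KZ.of_sub_of_mem_relations_of_affine` (KZLogCalculusProofs.lean), `β = 1`
  set U : Set (Fin 2 → ℝ) := {z | Fin.init z ∈ G ∧ a (Fin.init z) < z (Fin.last 1) ∧
    z (Fin.last 1) < b (Fin.init z)} with hU
  set V : Set (Fin 2 → ℝ) := {z | Fin.init z ∈ G ∧ a (Fin.init z) + η (Fin.init z) <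
    z (Fin.last 1) ∧ z (Fin.last 1) < b (Fin.init z) + η (Fin.init z)} with hV
  have hUG : U ⊆ {z | Fin.init z ∈ G} := fun z hz => hz.1
  have hUsa : IsSemialgebraic ℚ U := groundCell_isSemialgebraic_band ha hb
  have hUo : IsOpen U := groundCell_isOpen_band hGo hac hbc
  -- the shear
  set Φ : (Fin 2 → ℝ) → (Fin 2 → ℝ) := fun z =>
    Fin.snoc (Fin.init z) (z (Fin.last 1) + η (Fin.init z)) with hΦ
  -- continuous linear pieces
  let initL : (Fin 2 → ℝ) →L[ℝ] (Fin 1 → ℝ) :=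
    ContinuousLinearMap.pi fun i => ContinuousLinearMap.proj (Fin.castSucc i)
  let lastL : (Fin 2 → ℝ) →L[ℝ] ℝ := ContinuousLinearMap.proj (Fin.last 1)
  have hinitL : ∀ w, initL w = Fin.init w := fun w => rfl
  have hlastL : ∀ w, lastL w = w (Fin.last 1) := fun w => rfl
  let row : (Fin 2 → ℝ) → (Fin 2 → ℝ) →L[ℝ] ℝ := fun z =>
    (fderiv ℝ η (Fin.init z)).comp initL + lastL
  have hrow : ∀ z w, row z w = fderiv ℝ η (Fin.init z) (Fin.init w) + w (Fin.last 1) := by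
    intro z w
    simp [row, hinitL, hlastL, -Fin.reduceLast]
  let Φ' : (Fin 2 → ℝ) → (Fin 2 → ℝ) →L[ℝ] (Fin 2 → ℝ) := fun z =>
    ContinuousLinearMap.pi
      (Fin.lastCases (motive := fun _ => (Fin 2 → ℝ) →L[ℝ] ℝ) (row z)
        (fun i => ContinuousLinearMap.proj (Fin.castSucc i)))
  have hΦ' : ∀ z w, Φ' z w = Fin.snoc (Fin.init w) (row z w) := by
    intro z w
    funext i
    refine Fin.lastCases ?_ (fun j => ?_) i
    · simp [Φ', -Fin.reduceLast]
    · simp [Φ', Fin.init, -Fin.reduceLast]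
  -- determinant
  have hdet : ∀ z, (Φ' z).det = 1 := by
    intro z
    have h := LinearMap.det_of_snoc_init (Φ' z : (Fin 2 → ℝ) →ₗ[ℝ] (Fin 2 → ℝ))
      LinearMap.id ((fderiv ℝ η (Fin.init z) : (Fin 1 → ℝ) →L[ℝ] ℝ) : (Fin 1 → ℝ) →ₗ[ℝ] ℝ)
      1 (fun w => by
        rw [ContinuousLinearMap.coe_coe, hΦ', hrow]
        simp)
    rw [LinearMap.det_id, mul_one] at h
    exact h
  -- derivative
  have hηd' : ∀ y ∈ G, HasFDerivAt η (fderiv ℝ η y) y := fun y hy =>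
    ((hηd.differentiableOn one_ne_zero).differentiableAt (hGo.mem_nhds hy)).hasFDerivAt
  have hderiv : ∀ z : Fin 2 → ℝ, Fin.init z ∈ G → HasFDerivAt Φ (Φ' z) z := by
    intro z hz
    rw [hasFDerivAt_pi']
    intro i
    refine Fin.lastCases ?_ (fun j => ?_) i
    · have h1 : HasFDerivAt (fun x : Fin 2 → ℝ => Fin.init x) initL z := initL.hasFDerivAt
      have hηc := (hηd' _ hz).comp z h1
      have hl : HasFDerivAt (fun x : Fin 2 → ℝ => x (Fin.last 1)) lastL z :=
        hasFDerivAt_apply (Fin.last 1) z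
      have h := hηc.add hl
      have hfun : (fun x => Φ x (Fin.last 1)) =
          fun x => (η ∘ fun x : Fin 2 → ℝ => Fin.init x) x + x (Fin.last 1) := by
        funext x
        simp [hΦ, add_comm, -Fin.reduceLast]
      show HasFDerivAt (fun x => Φ x (Fin.last 1)) _ z
      rw [hfun]
      refine h.congr_fderiv (ContinuousLinearMap.ext fun w => ?_)
      simp only [ContinuousLinearMap.coe_comp, Function.comp_apply, hΦ', hrow]
      simp [hinitL, hlastL, -Fin.reduceLast]
    · have hfun : (fun x => Φ x (Fin.castSucc j)) = fun x => x (Fin.castSucc j) := by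
        funext x
        simp [hΦ, Fin.init, -Fin.reduceLast]
      show HasFDerivAt (fun x => Φ x (Fin.castSucc j)) _ z
      rw [hfun]
      refine (hasFDerivAt_apply (Fin.castSucc j) z).congr_fderiv
        (ContinuousLinearMap.ext fun w => ?_)
      simp [hΦ', Fin.init, -Fin.reduceLast]
  -- smoothness
  have hinitC : ContDiff ℝ 1 (fun x : Fin 2 → ℝ => Fin.init x) := initL.contDiff
  have hΦC1 : ContDiffOn ℝ 1 Φ U := by
    refine contDiffOn_pi' fun i => ?_
    refine Fin.lastCases ?_ (fun j => ?_) i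
    · have h := ((contDiff_apply ℝ ℝ (Fin.last 1)).contDiffOn (s := U)).add
        (hηd.comp hinitC.contDiffOn hUG)
      refine h.congr fun x _ => ?_
      simp [hΦ, -Fin.reduceLast]
    · refine ((contDiff_apply ℝ ℝ (Fin.castSucc j)).contDiffOn (s := U)).congr fun x _ => ?_
      simp [hΦ, Fin.init, -Fin.reduceLast]
  -- semialgebraicity
  have hηU : IsSemialgebraicFunOn ℚ U (fun z => η (Fin.init z)) := hη.comp_init_mono hUsa hUG
  have hlU := isSemialgebraicFunOn_apply hUsa (Fin.last 1)
  have hΦsa : IsSemialgebraicMapOn ℚ U Φ := by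
    refine IsSemialgebraicMapOn.of_forall hUsa fun i => ?_
    refine Fin.lastCases ?_ (fun j => ?_) i
    · exact (IsSemialgebraicFunOn.add_holds hlU hηU).congr fun z _ => by simp [hΦ, -Fin.reduceLast]
    · exact (isSemialgebraicFunOn_apply hUsa (Fin.castSucc j)).congr fun z _ => by
        simp [hΦ, Fin.init, -Fin.reduceLast]
  -- injectivity
  have hinj : InjOn Φ U := by
    intro z₁ _ z₂ _ h
    have hy : Fin.init z₁ = Fin.init z₂ := by
      have := congrArg Fin.init h
      simpa [hΦ, -Fin.reduceLast] using this
    have hl : z₁ (Fin.last 1) + η (Fin.init z₁) = z₂ (Fin.last 1) + η (Fin.init z₂) := by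
      have := congrFun h (Fin.last 1)
      simpa [hΦ, -Fin.reduceLast] using this
    rw [hy] at hl
    have hs : z₁ (Fin.last 1) = z₂ (Fin.last 1) := add_right_cancel hl
    rw [← Fin.snoc_init_self z₁, ← Fin.snoc_init_self z₂, hy, hs]
  -- image
  have himage : Φ '' U = V := by
    ext w
    simp only [mem_image]
    constructor
    · rintro ⟨z, hz, rfl⟩
      refine ⟨by simpa [hΦ, -Fin.reduceLast] using hz.1, ?_, ?_⟩
      · simp only [hΦ, Fin.init_snoc, Fin.snoc_last]
        linarith [hz.2.1]
      · simp only [hΦ, Fin.init_snoc, Fin.snoc_last]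
        linarith [hz.2.2]
    · intro hw
      refine ⟨Fin.snoc (Fin.init w) (w (Fin.last 1) - η (Fin.init w)), ?_, ?_⟩
      · refine ⟨by simpa using hw.1, ?_, ?_⟩
        · simp only [Fin.init_snoc, Fin.snoc_last]
          linarith [hw.2.1]
        · simp only [Fin.init_snoc, Fin.snoc_last]
          linarith [hw.2.2]
      · simp only [hΦ, Fin.init_snoc, Fin.snoc_last, sub_add_cancel, Fin.snoc_init_self]
  refine (HE U V).2 ⟨U, Φ, subset_rfl, hUsa, hUo, by simp, hΦsa, hΦC1, hinj, fun p hp => ?_,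
    himage.le, by simp [himage, -Fin.reduceLast]⟩
  rw [(hderiv p hp.1).fderiv, hdet, abs_one]

/-- **One band, grounded at height `S`.** Over an open `ℚ`-semialgebraic `C ⊆ ℝ¹`, the band
`a < t < b` (continuous `ℚ`-semialgebraic edges) is `E`-related to the band `S < t < S + (b − a)`
for every `ℚ`-semialgebraic `S`: the shift `η = S − a` is `C^∞` on an open `ℚ`-semialgebraic
`G ⊆ C` with `C \ G` null (`KZ.exists_isOpen_contDiffOn`), the shear over `G` is
`groundCell_shear`, and the cylinder over `C \ G` is null (`KZ.volume_setOf_init_mem_eq_zero`).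
[folklore] -/
theorem groundCell_band (E : Set (Fin 2 → ℝ) → Set (Fin 2 → ℝ) → Prop)
    (HE : ∀ A B : Set (Fin 2 → ℝ), E A B ↔
        ∃ (U : Set (Fin 2 → ℝ)) (Φ : (Fin 2 → ℝ) → (Fin 2 → ℝ)),
          U ⊆ A ∧ IsSemialgebraic ℚ U ∧ IsOpen U ∧ volume (A \ U) = 0 ∧
          IsSemialgebraicMapOn ℚ U Φ ∧ ContDiffOn ℝ 1 Φ U ∧ InjOn Φ U ∧
          (∀ p ∈ U, |(fderiv ℝ Φ p).det| = 1) ∧ Φ '' U ⊆ B ∧ volume (B \ Φ '' U) = 0)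
    {C : Set (Fin 1 → ℝ)} {a b S : (Fin 1 → ℝ) → ℝ} (hCsa : IsSemialgebraic ℚ C)
    (ha : IsSemialgebraicFunOn ℚ C a) (hb : IsSemialgebraicFunOn ℚ C b)
    (hS : IsSemialgebraicFunOn ℚ C S) (hac : ContinuousOn a C) (hbc : ContinuousOn b C) :
    E {z : Fin 2 → ℝ | Fin.init z ∈ C ∧ a (Fin.init z) < z (Fin.last 1) ∧
        z (Fin.last 1) < b (Fin.init z)}
      {z : Fin 2 → ℝ | Fin.init z ∈ C ∧ S (Fin.init z) < z (Fin.last 1) ∧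
        z (Fin.last 1) < S (Fin.init z) + (b (Fin.init z) - a (Fin.init z))} := by
  have hη : IsSemialgebraicFunOn ℚ C (fun x => S x - a x) := IsSemialgebraicFunOn.sub_holds hS ha
  obtain ⟨G, hGC, hGo, hGsa, hsmooth, -, hnull⟩ := KZ.exists_isOpen_contDiffOn hCsa hη
  have h1 := groundCell_shear E HE hGo (ha.mono hGC hGsa) (hb.mono hGC hGsa) (hη.mono hGC hGsa)
    (hac.mono hGC) (hbc.mono hGC) (hsmooth.of_le (by exact_mod_cast le_top))
  have hcyl : volume {z : Fin 2 → ℝ | Fin.init z ∈ C \ G} = 0 :=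
    KZ.volume_setOf_init_mem_eq_zero hnull
  refine groundCell_enlarge E HE h1 (fun z hz => ⟨hGC hz.1, hz.2⟩) ?_ (fun z hz => ?_) ?_
  · refine measure_mono_null (fun z hz => ?_) hcyl
    exact ⟨hz.1.1, fun hzG => hz.2 ⟨hzG, hz.1.2⟩⟩
  · refine ⟨hGC hz.1, ?_, ?_⟩
    · linarith [hz.2.1]
    · linarith [hz.2.2]
  · refine measure_mono_null (fun z hz => ?_) hcyl
    refine ⟨hz.1.1, fun hzG => hz.2 ⟨hzG, ?_, ?_⟩⟩
    · linarith [hz.1.2.1]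
    · linarith [hz.1.2.2]

/-- **Stacking bands by shears** (stub `stub_groundCell`): over an open `ℚ`-semialgebraic subset
`C` of the line, finitely many bands `fᵢ < t < gᵢ` (continuous `ℚ`-semialgebraic bounds, ordered:
`gᵢ ≤ fᵢ'` for `i < i'`) are carried, by the vertical shears `(x, t) ↦ (x, t − fᵢ x + Σ_{i'<i}
(gᵢ' − fᵢ') x)` (`|det| = 1`, `C¹` off the null set where some bound is not `C¹`, glued), onto the
subgraph `0 < t < Σᵢ (gᵢ − fᵢ)` up to null graphs.  Induction on the number of bands: the first
`k` bands go onto `0 < t < S_k`, the last one onto `S_k < t < S_k + (g_k − f_k)`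
(`groundCell_band`); sources and targets are disjoint, the instances glue, and the glued target
fills `0 < t < S_{k+1}` up to the null graph `t = S_k` (`KZ.volume_graph_eq_zero`). [folklore] -/
theorem stub_groundCell :
    ∀ (E : Set (Fin 2 → ℝ) → Set (Fin 2 → ℝ) → Prop),
      (∀ A B : Set (Fin 2 → ℝ), E A B ↔
        ∃ (U : Set (Fin 2 → ℝ)) (Φ : (Fin 2 → ℝ) → (Fin 2 → ℝ)),
          U ⊆ A ∧ IsSemialgebraic ℚ U ∧ IsOpen U ∧ volume (A \ U) = 0 ∧
          IsSemialgebraicMapOn ℚ U Φ ∧ ContDiffOn ℝ 1 Φ U ∧ InjOn Φ U ∧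
          (∀ p ∈ U, |(fderiv ℝ Φ p).det| = 1) ∧ Φ '' U ⊆ B ∧ volume (B \ Φ '' U) = 0) →
    (∀ A₁ A₂ B₁ B₂ : Set (Fin 2 → ℝ), volume (A₁ ∩ A₂) = 0 → Disjoint B₁ B₂ →
      E A₁ B₁ → E A₂ B₂ → E (A₁ ∪ A₂) (B₁ ∪ B₂)) →
    ∀ (k : ℕ) (C : Set (Fin 1 → ℝ)) (f g : Fin k → (Fin 1 → ℝ) → ℝ),
      IsOpen C → IsSemialgebraic ℚ C →
      (∀ i, IsSemialgebraicFunOn ℚ C (f i)) → (∀ i, IsSemialgebraicFunOn ℚ C (g i)) →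
      (∀ i, ContinuousOn (f i) C) → (∀ i, ContinuousOn (g i) C) →
      (∀ i, ∀ x ∈ C, f i x < g i x) →
      (∀ i i', i < i' → ∀ x ∈ C, g i x ≤ f i' x) →
      E (⋃ i, {z : Fin 2 → ℝ | Fin.init z ∈ C ∧ f i (Fin.init z) < z (Fin.last 1) ∧
            z (Fin.last 1) < g i (Fin.init z)})
        {z : Fin 2 → ℝ | Fin.init z ∈ C ∧ 0 < z (Fin.last 1) ∧
            z (Fin.last 1) < ∑ i, (g i (Fin.init z) - f i (Fin.init z))} := by
  intro E HE hglue k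
  induction k with
  | zero =>
    intro C f g _ _ _ _ _ _ _ _
    have hB : {z : Fin 2 → ℝ | Fin.init z ∈ C ∧ 0 < z (Fin.last 1) ∧
        z (Fin.last 1) < ∑ i : Fin 0, (g i (Fin.init z) - f i (Fin.init z))} = ∅ := by
      ext z
      simp only [Finset.univ_eq_empty, Finset.sum_empty, mem_setOf_eq, mem_empty_iff_false,
        iff_false, not_and, not_lt]
      exact fun _ h => h.le
    rw [iUnion_of_empty, hB]
    -- `E ∅ ∅`, witnessed by `U = ∅`
    exact (HE ∅ ∅).2 ⟨∅, id, subset_rfl, isSemialgebraic_empty, isOpen_empty, by simp,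
      isSemialgebraicMapOn_id isSemialgebraic_empty, contDiffOn_empty, injOn_empty _,
      fun p hp => hp.elim, by simp, by simp⟩
  | succ k ih =>
    intro C f g hC hCsa hf hg hfc hgc hfg hgf
    -- the first `k` bands, stacked onto `0 < t < S_k`
    have h1 := ih C (fun i => f (Fin.castSucc i)) (fun i => g (Fin.castSucc i)) hC hCsa
      (fun i => hf _) (fun i => hg _) (fun i => hfc _) (fun i => hgc _) (fun i => hfg _)
      (fun i i' hii' => hgf _ _ (Fin.castSucc_lt_castSucc_iff.2 hii'))
    -- the last band, stacked onto `S_k < t < S_k + (g_k - f_k)`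
    have hS : IsSemialgebraicFunOn ℚ C
        (fun x => ∑ i : Fin k, (g (Fin.castSucc i) x - f (Fin.castSucc i) x)) :=
      KZ.isSemialgebraicFunOn_finset_sum Finset.univ hCsa fun i _ =>
        IsSemialgebraicFunOn.sub_holds (hg (Fin.castSucc i)) (hf (Fin.castSucc i))
    have h2 := groundCell_band E HE hCsa (hf (Fin.last k)) (hg (Fin.last k)) hS (hfc _) (hgc _)
    -- glue
    have h3 := hglue _ _ _ _ ?_ ?_ h1 h2
    rotate_left
    · -- the sources are disjoint: `g i ≤ f k` for `i < k`
      refine measure_mono_null ?_ measure_empty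
      rintro z ⟨hz1, hz2⟩
      obtain ⟨i, hi⟩ := mem_iUnion.1 hz1
      have hle := hgf (Fin.castSucc i) (Fin.last k) (Fin.castSucc_lt_last i) _ hi.1
      exact (lt_irrefl _ ((hi.2.2.trans_le hle).trans hz2.2.1)).elim
    · -- the targets are disjoint
      exact Set.disjoint_left.2 fun z hz1 hz2 => lt_irrefl _ (hz1.2.2.trans hz2.2.1)
    -- the glued instance has the right source and, up to a null graph, the right target
    have hpos : ∀ x ∈ C, 0 ≤ ∑ i : Fin k, (g (Fin.castSucc i) x - f (Fin.castSucc i) x) :=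
      fun x hx => Finset.sum_nonneg fun i _ => sub_nonneg.2 (hfg _ x hx).le
    have hsum : ∀ x, ∑ i : Fin (k + 1), (g i x - f i x) =
        ∑ i : Fin k, (g (Fin.castSucc i) x - f (Fin.castSucc i) x) +
          (g (Fin.last k) x - f (Fin.last k) x) := fun x =>
      Fin.sum_univ_castSucc (fun i => g i x - f i x)
    refine groundCell_enlarge E HE h3 ?_ ?_ ?_ ?_
    · rintro z (hz | hz)
      · obtain ⟨i, hi⟩ := mem_iUnion.1 hz
        exact mem_iUnion.2 ⟨Fin.castSucc i, hi⟩
      · exact mem_iUnion.2 ⟨Fin.last k, hz⟩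
    · refine measure_mono_null ?_ measure_empty
      rintro z ⟨hz, hz'⟩
      obtain ⟨i, hi⟩ := mem_iUnion.1 hz
      refine hz' ?_
      induction i using Fin.lastCases with
      | last => exact Or.inr hi
      | cast j => exact Or.inl (mem_iUnion.2 ⟨j, hi⟩)
    · rintro z (hz | hz)
      · refine ⟨hz.1, hz.2.1, ?_⟩
        rw [hsum]
        linarith [hz.2.2, hfg (Fin.last k) _ hz.1]
      · refine ⟨hz.1, ?_, ?_⟩
        · linarith [hz.2.1, hpos _ hz.1]
        · rw [hsum]
          exact hz.2.2
    · refine measure_mono_null ?_ (KZ.volume_graph_eq_zero hS)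
      rintro z ⟨hz, hz'⟩
      refine ⟨hz.1, le_antisymm (not_lt.1 fun hlt => hz' (Or.inr ⟨hz.1, hlt, ?_⟩))
        (not_lt.1 fun hlt => hz' (Or.inl ⟨hz.1, hz.2.1, hlt⟩))⟩
      rw [← hsum]
      exact hz.2.2

end Summit.KontsevichZagierPeriods.SymplecticScissors.PlanarSAZylev
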